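import Literature.NumberTheory.QuadraticFields.ThreeTorsionMean
import Literature.NumberTheory.QuadraticFields.ThreeTorsionMeanSquarefreeCount
import Literature.NumberTheory.QuadraticFields.SquarefreeModFour
import Literature.NumberTheory.QuadraticFields.KroneckerSplitting
import Literature.NumberTheory.QuadraticFields.ImaginaryQuadraticPrescribedSplitting
import Literature.NumberTheory.EllipticCurves.BSDSelmerSmithProofs
import Literature.NumberTheory.EllipticCurves.HeegnerPoints
import HarnessLib

/-!
# C⁺odd(N,3) from Davenport–Heilbronn with Heegner local conditions (line `bed_at_three`, stub 3)

Crux `InertBadAtThree` (stmt-BirchSwinnertonDyer-19225, routes `InertBadSignedBranches` r4 /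
`BiquadraticEisensteinDescent` r5), line `bed_at_three` (bsd-idea-18 g3; lead `bsd-line-ibd-p1` g4),
registered stub `stub_nonNullOddIndivisibleHeegnerThree : NonNullOddIndivisibleHeegnerThree`:

  for every level `N ≠ 0`, the squarefree `d` that are discriminants of imaginary quadratic `K`
  with `|d| > 4`, `d` odd, every `ℓ ∣ N` split in `K` and `3 ∤ h_K` are NOT a `twistDensity`-null set.

THEOREMS ONLY (no definition, no named fact, no sorry). The single printed input is taken BY VALUE
as the hypothesis `hmean` — the Davenport–Heilbronn mean with finitely many local conditions
(Bhargava–Varma, Proc. LMS 112 (2016), Cor. 4 (a): over the imaginary quadratic fields with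
prescribed local behaviour at a finite set of primes, ordered by `|d_K|`, the average of `#Cl(K)[3]`
is `2`), for the local conditions "`2` unramified (`d_K` odd), every prime factor of `N` split",
in the carriers of `Literature/NumberTheory/QuadraticFields/ThreeTorsionMean.lean`
(`negFundDiscrs X` = fundamental discriminants `-X < D < 0`, `quadFieldThreeTorsion D = #Cl₃(D)`).
Everything else is PROVED here from the tree:

* §1 `mem_heegnerOddFamily_of_modEq_one` — a squarefree `D < 0` with `D ≡ 1 (mod 8N)` is an odd
  fundamental discriminant whose field `ℚ(√D)` satisfies the Heegner hypothesis for `N`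
  (decomposition laws `Quadratic.ncard_primesOver_two_eq_two_iff` / `…_iff_jacobiSym`,
  existence of the field `Quadratic.exists_numberField_discr_eq`);
* §2 `exists_pos_tendsto_card_progression_div` — `#{-X < D < 0 : D ≡ 1 (mod 8N), D squarefree} / X`
  tends to a POSITIVE constant (the tree's PROVED squarefree count in coprime progressions,
  `abs_card_squarefree_modEq_sub_le`, Prachar / Montgomery–Vaughan), so the odd Heegner family has
  positive lower density;
* §3 `three_mul_card_sub_two_mul_card_le_sum` — `#Cl₃(D) ∈ {1} ∪ 3ℕ`, hence
  `3·#family − 2·#{3 ∤ h} ≤ Σ #Cl₃`; with the mean `→ 2` at least a quarter of the family has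
  `3 ∤ h` eventually;
* §4 `nonNullOddIndivisibleHeegnerThree_of_mean` — the members with `3 ∤ h` (minus `D = -3`) lie in
  the stub's counting set, the reference count `#{d squarefree : |d| ≤ X}` is `≤ 2X + 1`, so the
  `twistDensity` ratio is eventually bounded below by a positive constant: it cannot tend to `0`.
  The final theorem's type is LITERALLY `(Bhargava–Varma mean, by value) → NonNullOddIndivisibleHeegnerThree`
  (the registered stub's statement, by value).

Lead's use: the mean hypothesis joins the line's held print-input conjunction `PrintedInputsAtThree`
(reshape of skeleton `Lines/bed_at_three.lean`), and stub 3 becomes a theorem. BSD is not proved by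
any of this; the crux 19225 is not closed by this file (its heart `stub_heartAtThree` is open research).
-/

set_option linter.dupNamespace false -- `Summit.BirchSwinnertonDyer.BirchSwinnertonDyer.Theorems.…` (summit = sub, D-0017)
set_option autoImplicit false

noncomputable section

open scoped Classical
open Finset Filter Topology
open Literature.NumberTheory.QuadraticFields Literature.NumberTheory.QuadraticFields.Quadratic
  Literature.NumberTheory.EllipticCurves

namespace Summit.BirchSwinnertonDyer.BirchSwinnertonDyer.Theorems.InertBadSignedBranchesInertBadAtThreeNonNullOddHeegner

/-! ### §1 The progression `D ≡ 1 (mod 8N)` lies in the odd Heegner family of level `N` -/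

/-- A squarefree `D < 0` with `D ≡ 1 (mod 8N)` (`N ≠ 0`) is odd and is the discriminant of an
imaginary quadratic field in which every prime factor of `N` splits: `D ≡ 1 (mod 8)` makes `2`
split and `D ≡ 1 (mod ℓ)` makes an odd `ℓ ∣ N` split (decomposition laws of `KroneckerSplitting`).
[folklore] -/
theorem mem_heegnerOddFamily_of_modEq_one {N : ℕ} {D : ℤ}
    (hD1 : D ≡ 1 [ZMOD ((8 * N : ℕ) : ℤ)]) (hsq : Squarefree D) (hD0 : D < 0) :
    Odd D ∧ ∃ (K : Type) (_ : Field K) (_ : NumberField K),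
      IsImaginaryQuadratic K ∧ NumberField.discr K = D ∧ SatisfiesHeegnerHypothesis N K := by
  have h8 : D ≡ 1 [ZMOD 8] :=
    hD1.of_dvd ⟨(N : ℤ), by push_cast; ring⟩
  have h8' : D % 8 = 1 := h8
  have h4 : D % 4 = 1 := by omega
  have hodd : Odd D := by
    rw [Int.odd_iff]
    omega
  have hfund : (D % 4 = 1 ∧ Squarefree D ∧ D ≠ 1) ∨
      (4 ∣ D ∧ (D / 4 % 4 = 2 ∨ D / 4 % 4 = 3) ∧ Squarefree (D / 4)) :=
    Or.inl ⟨h4, hsq, by omega⟩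
  obtain ⟨K, iF, iN, h2, hdisc⟩ := exists_numberField_discr_eq hfund
  refine ⟨hodd, K, iF, iN, ⟨h2, isTotallyComplex_of_discr_neg h2 (hdisc ▸ hD0)⟩, hdisc, ?_⟩
  intro p hp hpN
  have hpdvd : (p : ℤ) ∣ ((8 * N : ℕ) : ℤ) := by
    exact_mod_cast Dvd.intro_left 8 rfl |>.trans (mul_dvd_mul_left 8 hpN)
  have hDp : D ≡ 1 [ZMOD p] := hD1.of_dvd hpdvd
  by_cases hp2 : p = 2
  · subst hp2
    have h := (ncard_primesOver_two_eq_two_iff h2).mpr (by rw [hdisc]; exact h8')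
    simpa using h
  · rw [ncard_primesOver_eq_two_iff_jacobiSym h2 hp hp2, hdisc, jacobiSym.mod_left' hDp,
      jacobiSym.one_left]

/-- Hence the squarefree `-X < D < 0` with `D ≡ 1 (mod 8N)` form a subset of the odd Heegner family
of level `N` among the negative fundamental discriminants `-X < D < 0`. [folklore] -/
theorem card_progression_le_card_heegnerOddFamily (N X : ℕ) :
    ((Ico (-(X : ℤ) + 1) 0).filter (fun x => x ≡ 1 [ZMOD ((8 * N : ℕ) : ℤ)] ∧ Squarefree x)).card ≤
      ((negFundDiscrs X).filter (fun D => Odd D ∧ ∃ (K : Type) (_ : Field K) (_ : NumberField K),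
        IsImaginaryQuadratic K ∧ NumberField.discr K = D ∧ SatisfiesHeegnerHypothesis N K)).card := by
  refine Finset.card_le_card fun x hx => ?_
  rw [Finset.mem_filter, Finset.mem_Ico] at hx
  obtain ⟨⟨hx1, hx0⟩, hmod, hsq⟩ := hx
  have h8 : x ≡ 1 [ZMOD 8] := hmod.of_dvd ⟨(N : ℤ), by push_cast; ring⟩
  have h8' : x % 8 = 1 := h8
  rw [Finset.mem_filter, mem_negFundDiscrs]
  exact ⟨⟨⟨by omega, hx0⟩, Or.inl ⟨by omega, hsq, by omega⟩⟩,
    mem_heegnerOddFamily_of_modEq_one hmod hsq hx0⟩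

/-! ### §2 The progression has positive density -/

/-- `#{-X < D < 0 : D ≡ 1 (mod 8N), D squarefree} / X → c` for some `c > 0` (in fact
`c = (6/π²) Π_{p ∣ 8N} (1 − p⁻²)⁻¹ / (8N)`), from the tree's squarefree count in a coprime
residue class with error `5√X` (`abs_card_squarefree_modEq_sub_le`). [folklore] -/
theorem exists_pos_tendsto_card_progression_div {N : ℕ} (hN : N ≠ 0) :
    ∃ c : ℝ, 0 < c ∧ Tendsto (fun X : ℕ =>
      (((Ico (-(X : ℤ) + 1) 0).filter
        (fun x => x ≡ 1 [ZMOD ((8 * N : ℕ) : ℤ)] ∧ Squarefree x)).card : ℝ) / X) atTop (𝓝 c) := by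
  have hL0 : 0 < 8 * N := by omega
  have hE0 : 0 < 6 / Real.pi ^ 2 * ∏ p ∈ (8 * N).primeFactors, (1 - 1 / (p : ℝ) ^ 2)⁻¹ := by
    refine mul_pos (by positivity) (Finset.prod_pos fun p hp => ?_)
    have hp2 : (2 : ℝ) ≤ p := by exact_mod_cast (Nat.prime_of_mem_primeFactors hp).two_le
    have : (1 : ℝ) / (p : ℝ) ^ 2 < 1 := by
      rw [div_lt_one (by positivity)]
      nlinarith
    exact inv_pos.mpr (by linarith)
  -- the density of the progression
  refine ⟨(6 / Real.pi ^ 2 * ∏ p ∈ (8 * N).primeFactors, (1 - 1 / (p : ℝ) ^ 2)⁻¹) / ((8 * N : ℕ) : ℝ),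
    div_pos hE0 (by exact_mod_cast hL0), ?_⟩
  set c : ℝ := (6 / Real.pi ^ 2 * ∏ p ∈ (8 * N).primeFactors, (1 - 1 / (p : ℝ) ^ 2)⁻¹) /
    ((8 * N : ℕ) : ℝ) with hc
  have hc0 : 0 < c := div_pos hE0 (by exact_mod_cast hL0)
  refine tendsto_div_of_abs_sub_le_sqrt (C := 5 + c) fun X => ?_
  rcases Nat.eq_zero_or_pos X with rfl | hX
  · simp
  have h1 : (1 : ℝ) ≤ Real.sqrt X := by
    rw [Real.le_sqrt (by norm_num) (Nat.cast_nonneg _)]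
    exact_mod_cast hX
  have hgcd : Int.gcd 1 (8 * N : ℕ) = 1 := by simp [Int.gcd]
  have h := abs_card_squarefree_modEq_sub_le hL0 (c := 1) hgcd (a := -(X : ℤ) + 1) (b := 0)
    (by omega) (Or.inl le_rfl) (M := X) (by omega) (by simp)
  have hmain : ((0 : ℤ) : ℝ) - ((-(X : ℤ) + 1 : ℤ) : ℝ) = (X : ℝ) - 1 := by push_cast; ring
  have hkey : ((X : ℝ) - 1) / ((8 * N : ℕ) : ℝ) *
      (6 / Real.pi ^ 2 * ∏ p ∈ (8 * N).primeFactors, (1 - 1 / (p : ℝ) ^ 2)⁻¹) = c * X - c := by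
    rw [hc]
    ring
  rw [hmain, hkey] at h
  have h3 : |c * (X : ℝ) - c - c * X| = c := by
    rw [show c * (X : ℝ) - c - c * X = -c by ring, abs_neg, abs_of_pos hc0]
  calc |((((Ico (-(X : ℤ) + 1) 0).filter
        (fun x => x ≡ 1 [ZMOD ((8 * N : ℕ) : ℤ)] ∧ Squarefree x)).card : ℝ)) - c * X|
        ≤ |((((Ico (-(X : ℤ) + 1) 0).filter
            (fun x => x ≡ 1 [ZMOD ((8 * N : ℕ) : ℤ)] ∧ Squarefree x)).card : ℝ)) - (c * X - c)| +
          |c * (X : ℝ) - c - c * X| := abs_sub_le _ _ _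
    _ ≤ 5 * Real.sqrt X + c := by rw [h3]; linarith
    _ ≤ 5 * Real.sqrt X + c * Real.sqrt X := by nlinarith
    _ = (5 + c) * Real.sqrt X := by ring

/-! ### §3 From the mean `2` to a quarter of the family with `3 ∤ h` -/

/-- `#Cl₃(D)` is `1` or at least `3` (a power of `3`), so over any finite family `Q`:
`3·#Q − 2·#{D ∈ Q : #Cl₃(D) = 1} ≤ Σ_{D ∈ Q} #Cl₃(D)`. [folklore] -/
theorem three_mul_card_sub_two_mul_card_le_sum (Q : Finset ℤ) :
    3 * (Q.card : ℝ) - 2 * ((Q.filter fun D => quadFieldThreeTorsion D = 1).card : ℝ) ≤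
      ∑ D ∈ Q, (quadFieldThreeTorsion D : ℝ) := by
  have hpt : ∀ D ∈ Q, (3 : ℝ) - 2 * (if quadFieldThreeTorsion D = 1 then (1 : ℝ) else 0) ≤
      (quadFieldThreeTorsion D : ℝ) := by
    intro D _
    obtain ⟨r, hr⟩ := exists_quadFieldThreeTorsion_eq_pow D
    split_ifs with h1
    · rw [h1]; norm_num
    · have hr0 : r ≠ 0 := by
        rintro rfl
        exact h1 (by rw [hr, pow_zero])
      have h3 : (3 : ℕ) ≤ quadFieldThreeTorsion D := by
        rw [hr]
        calc (3 : ℕ) = 3 ^ 1 := (pow_one 3).symm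
          _ ≤ 3 ^ r := Nat.pow_le_pow_right (by norm_num) (Nat.one_le_iff_ne_zero.mpr hr0)
      have h3' : (3 : ℝ) ≤ (quadFieldThreeTorsion D : ℝ) := by exact_mod_cast h3
      linarith
  have hsum := Finset.sum_le_sum hpt
  rw [Finset.sum_sub_distrib, Finset.sum_const, ← Finset.mul_sum, Finset.sum_boole] at hsum
  simpa [nsmul_eq_mul, mul_comm] using hsum

/-! ### §4 Non-nullity -/

/-- The reference count of `twistDensity` is at most `2X + 1` (the squarefree `d` with `|d| ≤ X`
lie in `[-X, X]`). [folklore] -/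
theorem natCard_squarefree_abs_le_le (X : ℕ) :
    (Nat.card {d : ℤ | Squarefree d ∧ |d| ≤ (X : ℤ)} : ℝ) ≤ 2 * X + 1 := by
  have hsub : {d : ℤ | Squarefree d ∧ |d| ≤ (X : ℤ)} ⊆ ↑(Finset.Icc (-(X : ℤ)) X) := by
    intro d hd
    rw [Finset.coe_Icc, Set.mem_Icc]
    exact abs_le.mp hd.2
  have h := Set.ncard_le_ncard hsub (Finset.finite_toSet _)
  rw [Set.ncard_coe_finset, Int.card_Icc] at h
  have htn : ((X : ℤ) + 1 - -(X : ℤ)).toNat = 2 * X + 1 := by omega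
  rw [htn, ← Nat.card_coe_set_eq] at h
  exact_mod_cast h

/-- The reference count is positive for `X ≥ 1` (`d = 1` is squarefree). [folklore] -/
theorem natCard_squarefree_abs_le_pos {X : ℕ} (hX : 1 ≤ X) :
    0 < Nat.card {d : ℤ | Squarefree d ∧ |d| ≤ (X : ℤ)} := by
  haveI : Finite {d : ℤ | Squarefree d ∧ |d| ≤ (X : ℤ)} := (finite_setOf_squarefree_abs_le' X).to_subtype
  haveI : Nonempty {d : ℤ | Squarefree d ∧ |d| ≤ (X : ℤ)} :=
    ⟨⟨1, squarefree_one, by rw [abs_one]; exact_mod_cast hX⟩⟩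
  exact Nat.card_pos

/-- The members of the odd Heegner family with `#Cl₃(D) = 1`, except possibly `D = -3`, lie in the
stub's counting set `{d squarefree : |d| ≤ X, ∃ K imaginary quadratic, d_K = d, |d| > 4, d odd,
Heegner for N, 3 ∤ h_K}` (`3 ∣ h_K ↔ 1 < #Cl(K)[3]`, `ThreeTorsion`). [folklore] -/
theorem card_erase_le_natCard_stubSet (N X : ℕ) :
    ((((negFundDiscrs X).filter (fun D => Odd D ∧ ∃ (K : Type) (_ : Field K) (_ : NumberField K),
        IsImaginaryQuadratic K ∧ NumberField.discr K = D ∧ SatisfiesHeegnerHypothesis N K)).filter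
        (fun D => quadFieldThreeTorsion D = 1)).erase (-3)).card ≤
      Nat.card {d : ℤ | Squarefree d ∧ |d| ≤ (X : ℤ) ∧
        ∃ (K : Type) (_ : Field K) (_ : NumberField K), IsImaginaryQuadratic K ∧
          NumberField.discr K = d ∧ 4 < d.natAbs ∧ Odd d ∧ SatisfiesHeegnerHypothesis N K ∧
          ¬ 3 ∣ NumberField.classNumber K} := by
  set U := (((negFundDiscrs X).filter (fun D => Odd D ∧ ∃ (K : Type) (_ : Field K) (_ : NumberField K),
        IsImaginaryQuadratic K ∧ NumberField.discr K = D ∧ SatisfiesHeegnerHypothesis N K)).filter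
        (fun D => quadFieldThreeTorsion D = 1)).erase (-3) with hU
  have hsub : (↑U : Set ℤ) ⊆ {d : ℤ | Squarefree d ∧ |d| ≤ (X : ℤ) ∧
        ∃ (K : Type) (_ : Field K) (_ : NumberField K), IsImaginaryQuadratic K ∧
          NumberField.discr K = d ∧ 4 < d.natAbs ∧ Odd d ∧ SatisfiesHeegnerHypothesis N K ∧
          ¬ 3 ∣ NumberField.classNumber K} := by
    intro D hD
    rw [Finset.mem_coe, hU, Finset.mem_erase, Finset.mem_filter, Finset.mem_filter,
      mem_negFundDiscrs] at hD
    obtain ⟨hD3, ⟨⟨⟨hDX, hD0⟩, hfund⟩, hodd, K, iF, iN, hK, hdisc, hH⟩, ht1⟩ := hD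
    have hsq4 : D % 4 = 1 ∧ Squarefree D := by
      rcases hfund with ⟨h4, hsq, -⟩ | ⟨h4dvd, -, -⟩
      · exact ⟨h4, hsq⟩
      · exfalso
        rw [Int.odd_iff] at hodd
        omega
    refine ⟨hsq4.2, abs_le.mpr ⟨by omega, by omega⟩, K, iF, iN, hK, hdisc, by omega, hodd, hH, ?_⟩
    rw [three_dvd_classNumber_iff_one_lt_natCard K, ← quadFieldThreeTorsion_eq D K hK.1 hdisc, ht1]
    decide
  have h := Nat.card_mono (finite_setOf_squarefree_abs_le X _) hsub
  rwa [Nat.card_coe_set_eq, Set.ncard_coe_finset] at h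

/-- **C⁺odd(N,3) at one level from the Bhargava–Varma mean.** If the average of `#Cl₃` over the
odd Heegner family of level `N ≠ 0` (imaginary quadratic `K`, `d_K` odd, every prime factor of `N`
split, ordered by `|d_K|`) tends to `2` [Bhargava–Varma 2016, Cor. 4 (a) for these local conditions,
taken BY VALUE as `hmean`], then the odd Heegner discriminants with `3 ∤ h` are not a
`twistDensity`-null set. [cite: BhargavaVarma2016, Cor. 4 (a)] -/
theorem not_twistDensity_zero_of_mean {N : ℕ} (hN : N ≠ 0)
    (hmean : Tendsto (fun X : ℕ =>
      (∑ D ∈ (negFundDiscrs X).filter (fun D => Odd D ∧ ∃ (K : Type) (_ : Field K) (_ : NumberField K),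
          IsImaginaryQuadratic K ∧ NumberField.discr K = D ∧ SatisfiesHeegnerHypothesis N K),
          (quadFieldThreeTorsion D : ℝ)) /
        (((negFundDiscrs X).filter (fun D => Odd D ∧ ∃ (K : Type) (_ : Field K) (_ : NumberField K),
          IsImaginaryQuadratic K ∧ NumberField.discr K = D ∧ SatisfiesHeegnerHypothesis N K)).card : ℝ))
      atTop (𝓝 2)) :
    ¬ twistDensity (fun d : ℤ ↦ ∃ (K : Type) (_ : Field K) (_ : NumberField K),
        IsImaginaryQuadratic K ∧ NumberField.discr K = d ∧ 4 < d.natAbs ∧ Odd d ∧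
        SatisfiesHeegnerHypothesis N K ∧ ¬ 3 ∣ NumberField.classNumber K) 0 := by
  intro hT
  -- names for the counting functions
  set Q : ℕ → Finset ℤ := fun X => (negFundDiscrs X).filter (fun D => Odd D ∧
      ∃ (K : Type) (_ : Field K) (_ : NumberField K),
        IsImaginaryQuadratic K ∧ NumberField.discr K = D ∧ SatisfiesHeegnerHypothesis N K) with hQ
  set T : ℕ → Finset ℤ := fun X => (Ico (-(X : ℤ) + 1) 0).filter
      (fun x => x ≡ 1 [ZMOD ((8 * N : ℕ) : ℤ)] ∧ Squarefree x) with hTdef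
  set G : ℕ → Finset ℤ := fun X => (Q X).filter (fun D => quadFieldThreeTorsion D = 1) with hG
  set Num : ℕ → ℝ := fun X => (Nat.card {d : ℤ | Squarefree d ∧ |d| ≤ (X : ℤ) ∧
      ∃ (K : Type) (_ : Field K) (_ : NumberField K), IsImaginaryQuadratic K ∧
        NumberField.discr K = d ∧ 4 < d.natAbs ∧ Odd d ∧ SatisfiesHeegnerHypothesis N K ∧
        ¬ 3 ∣ NumberField.classNumber K} : ℝ) with hNum
  set Den : ℕ → ℝ := fun X => (Nat.card {d : ℤ | Squarefree d ∧ |d| ≤ (X : ℤ)} : ℝ) with hDen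
  -- §2: the progression count `T X / X → c > 0`
  obtain ⟨c, hc0, hTc⟩ := exists_pos_tendsto_card_progression_div hN
  -- the comparison function `((T X)/4 - 1) / (2X + 1) → c/8`
  have hcmp : Tendsto (fun X : ℕ => (((T X).card : ℝ) / 4 - 1) / (2 * X + 1)) atTop (𝓝 (c / 8)) := by
    have h1 : Tendsto (fun X : ℕ => (1 : ℝ) / X) atTop (𝓝 0) :=
      tendsto_const_nhds.div_atTop tendsto_natCast_atTop_atTop
    have hnum : Tendsto (fun X : ℕ => ((T X).card : ℝ) / X / 4 - 1 / X) atTop (𝓝 (c / 4 - 0)) :=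
      (hTc.div_const 4).sub h1
    have hden : Tendsto (fun X : ℕ => (2 : ℝ) + 1 / X) atTop (𝓝 (2 + 0)) :=
      tendsto_const_nhds.add h1
    have hq := hnum.div hden (by norm_num)
    rw [sub_zero, add_zero, show c / 4 / 2 = c / 8 by ring] at hq
    refine hq.congr' ?_
    filter_upwards [eventually_gt_atTop 0] with X hX
    have hX0 : (X : ℝ) ≠ 0 := by positivity
    simp only [Pi.div_apply]
    field_simp
  -- eventually the comparison function exceeds `c / 16`
  have hev1 : ∀ᶠ X : ℕ in atTop, c / 16 < (((T X).card : ℝ) / 4 - 1) / (2 * X + 1) :=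
    (tendsto_order.1 hcmp).1 _ (by linarith)
  -- eventually the mean is `< 5/2`
  have hev2 : ∀ᶠ X : ℕ in atTop,
      (∑ D ∈ Q X, (quadFieldThreeTorsion D : ℝ)) / ((Q X).card : ℝ) < 5 / 2 :=
    (tendsto_order.1 hmean).2 _ (by norm_num)
  -- eventually the density ratio is `< c / 16`
  have hev3 : ∀ᶠ X : ℕ in atTop, Num X / Den X < c / 16 :=
    (tendsto_order.1 hT).2 _ (by positivity)
  obtain ⟨X, hX1, h1, h2, h3⟩ :=
    ((eventually_ge_atTop 1).and (hev1.and (hev2.and hev3))).exists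
  -- the chain of inequalities at this `X`
  have hX0 : (0 : ℝ) < 2 * X + 1 := by positivity
  have hTQ : ((T X).card : ℝ) ≤ ((Q X).card : ℝ) := by
    exact_mod_cast card_progression_le_card_heegnerOddFamily N X
  -- from the mean: `S < 5/2 · #Q`, hence `#G ≥ #Q / 4`
  have hGQ : ((Q X).card : ℝ) / 4 ≤ ((G X).card : ℝ) := by
    have hS := three_mul_card_sub_two_mul_card_le_sum (Q X)
    rcases Nat.eq_zero_or_pos (Q X).card with hQ0 | hQpos
    · have hG0 : (G X).card = 0 := by
        rw [← Nat.le_zero, ← hQ0]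
        exact Finset.card_filter_le _ _
      rw [hQ0, hG0]
      norm_num
    · have hQpos' : (0 : ℝ) < (Q X).card := by exact_mod_cast hQpos
      have hS' : (∑ D ∈ Q X, (quadFieldThreeTorsion D : ℝ)) < 5 / 2 * ((Q X).card : ℝ) := by
        rwa [div_lt_iff₀ hQpos'] at h2
      change 3 * ((Q X).card : ℝ) - 2 * ((G X).card : ℝ) ≤ _ at hS
      linarith
  -- the numerator: `Num ≥ #G - 1`
  have hNumG : ((G X).card : ℝ) - 1 ≤ Num X := by
    have h := card_erase_le_natCard_stubSet N X
    have h' : (G X).card - 1 ≤ ((G X).erase (-3)).card := Finset.pred_card_le_card_erase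
    have h'' : (G X).card ≤ Nat.card {d : ℤ | Squarefree d ∧ |d| ≤ (X : ℤ) ∧
        ∃ (K : Type) (_ : Field K) (_ : NumberField K), IsImaginaryQuadratic K ∧
          NumberField.discr K = d ∧ 4 < d.natAbs ∧ Odd d ∧ SatisfiesHeegnerHypothesis N K ∧
          ¬ 3 ∣ NumberField.classNumber K} + 1 := by
      change ((G X).erase (-3)).card ≤ _ at h
      omega
    have : ((G X).card : ℝ) ≤ Num X + 1 := by
      simp only [hNum]
      exact_mod_cast h''
    linarith
  -- the denominator: `0 < Den ≤ 2X + 1`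
  have hDenle : Den X ≤ 2 * X + 1 := natCard_squarefree_abs_le_le X
  have hDenpos : 0 < Den X := by
    simp only [hDen]
    exact_mod_cast natCard_squarefree_abs_le_pos hX1
  have hNum0 : 0 ≤ Num X := Nat.cast_nonneg _
  -- assemble
  have hchain : c / 16 < Num X / Den X :=
    calc c / 16 < (((T X).card : ℝ) / 4 - 1) / (2 * X + 1) := h1
      _ ≤ (((Q X).card : ℝ) / 4 - 1) / (2 * X + 1) := by gcongr
      _ ≤ (((G X).card : ℝ) - 1) / (2 * X + 1) := by gcongr
      _ ≤ Num X / (2 * X + 1) := by gcongr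
      _ ≤ Num X / Den X := div_le_div_of_nonneg_left hNum0 hDenpos hDenle
  exact absurd h3 (not_lt.mpr hchain.le)

/-- **Stub 3 of line `bed_at_three` from the printed mean, all levels at once.** The type is literally
`(Bhargava–Varma Cor. 4 (a) for the odd Heegner families, by value) → NonNullOddIndivisibleHeegnerThree`
(the registered stub statement of `Cruxes/InertBadAtThree/Lines/bed_at_three.lean`, by value).
[cite: BhargavaVarma2016, Cor. 4 (a)] -/
theorem nonNullOddIndivisibleHeegnerThree_of_mean
    (hmean : ∀ (N : ℕ), N ≠ 0 → Tendsto (fun X : ℕ =>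
      (∑ D ∈ (negFundDiscrs X).filter (fun D => Odd D ∧ ∃ (K : Type) (_ : Field K) (_ : NumberField K),
          IsImaginaryQuadratic K ∧ NumberField.discr K = D ∧ SatisfiesHeegnerHypothesis N K),
          (quadFieldThreeTorsion D : ℝ)) /
        (((negFundDiscrs X).filter (fun D => Odd D ∧ ∃ (K : Type) (_ : Field K) (_ : NumberField K),
          IsImaginaryQuadratic K ∧ NumberField.discr K = D ∧ SatisfiesHeegnerHypothesis N K)).card : ℝ))
      atTop (𝓝 2)) :
    ∀ (N : ℕ), N ≠ 0 → ¬ twistDensity (fun d : ℤ ↦ ∃ (K : Type) (_ : Field K) (_ : NumberField K),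
      IsImaginaryQuadratic K ∧ NumberField.discr K = d ∧ 4 < d.natAbs ∧ Odd d ∧
      SatisfiesHeegnerHypothesis N K ∧ ¬ 3 ∣ NumberField.classNumber K) 0 :=
  fun N hN => not_twistDensity_zero_of_mean hN (hmean N hN)

end Summit.BirchSwinnertonDyer.BirchSwinnertonDyer.Theorems.InertBadSignedBranchesInertBadAtThreeNonNullOddHeegner

end
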